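import Summits.QuantumFields.YangMills.Theorems.LuscherReductionOneSiteLevelsKacDefs
import Literature.Analysis.UnboundedOperators.HeatSmoothingDefect
import Literature.Analysis.UnboundedOperators.HeatExtensionHarnack

/-!
# INNER, flat lane (layer III): the heat-semigroup dictionary for the Kac form on `ℝ⁹`

Support module of crux `OneSiteLevels` (route `LuscherReduction`, item stmt-QuantumFields-20007), FLAT lane of the
registered v12 stub `stub_flatKacAL1 : (∀ k, LuscherHamiltonianEigenfunctions k) → ∀ k, FlatKacFormBound k`
(STUB-PLAN `Cruxes/OneSiteLevels/STUB-PLAN-stub_absUpperInnerAL1.md` rev 3, §2.2b «heat-toolkit dictionary»).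

The KacDefs objects `heatKernel t x y = (2πt)^{-9/2} e^{−‖x−y‖²/(2t)}` and `heatSmooth t g = P_t g = e^{−tH₀} g`
(`H₀ = −½Δ` on `ZM = ℝ⁹`) are the tree's Gauss–Weierstrass kernel and caloric extension
(`Literature.Analysis.UnboundedOperators.heatKernel / heatExtension`, `e^{τΔ}`) at HALF time: `P_t = e^{(t/2)Δ}`.
This file records the dictionary and transports the toolkit theorems the flat lane needs:

* §1 `heatKernel_eq_heatKernelUO`, `heatSmooth_eq_heatExtension` (the dictionary, no hypotheses);
  symmetry / positivity / mass one of the kernel; the maximum principle `|P_t g| ≤ M`; smoothness `P_t g ∈ C^n`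
  for `L^p` data; measurability; `L²`/`L¹` bookkeeping for bounded integrable data.
* §2 `integral_mul_heatSmooth_eq_sq` (`⟨g, P_t g⟩ = ‖P_{t/2} g‖²`), the Ledoux defect
  `∫ (f − P_s f)² ≤ (s/2) ∫ ‖Df‖²`, and the transposition `⟨P_s u, v⟩ = ⟨u, P_s v⟩`.
* §3 the jump expansion `flatJump t g = t⁻¹ (∫ g² − ⟨g, P_t g⟩)` (III.1′) and the MASS-DEFECT form
  `flatJump t g = t⁻¹ (‖g‖² − ‖P_{t/2} g‖²)` (III.1), `0 ≤ flatJump`, `flatJump ≤ kacForm`.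

All statements carry the Bochner side conditions (measurable, bounded, integrable) under which the integrals are
genuine (trap 16 of the plan).  Real analysis only ([folklore]); NOT the stub; femto rung R2b1; NOT a claim about the gap.
References: M. Ledoux, Math. Res. Lett. 10 (2003) §1; L. C. Evans, PDE, §2.3.1; E. H. Lieb, H.-T. Yau, CMP 118 (1988) (2.9)–(2.11).
-/

set_option autoImplicit false

noncomputable section

open MeasureTheory Filter Topology Real
open Literature.Analysis.OperatorTheory.YMMatrixModel

namespace Summit.QuantumFields.YangMills.Theorems.FemtoTransferGap

/-! ### §1. The dictionary -/

/-- `finrank ℝ ZM = 9`. [folklore] -/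
theorem finrank_ZM : Module.finrank ℝ ZM = 9 := by
  rw [finrank_euclideanSpace]; simp

/-- D1′: the KacDefs kernel is the Gauss–Weierstrass kernel at time `t/2`: `p_t(x,y) = G_{t/2}(x − y)`
(`finrank ℝ ZM = 9`, `4·(t/2) = 2t`). [folklore] -/
theorem heatKernel_eq_heatKernelUO (t : ℝ) (x y : ZM) :
    heatKernel t x y = Literature.Analysis.UnboundedOperators.heatKernel (t / 2) (x - y) := by
  have h9 : (Module.finrank ℝ ZM : ℝ) = 9 := by rw [finrank_ZM]; norm_num
  unfold heatKernel Literature.Analysis.UnboundedOperators.heatKernel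
  rw [h9]
  congr 1
  · congr 1; ring
  · congr 1; ring

/-- D1: `heatSmooth t g = e^{(t/2)Δ} g` pointwise, for every `g` (no hypotheses: both sides are the same Bochner
integral, junk values included). [folklore] -/
theorem heatSmooth_eq_heatExtension (t : ℝ) (g : ZM → ℝ) :
    heatSmooth t g = Literature.Analysis.UnboundedOperators.heatExtension g (t / 2) := by
  funext x
  rw [Literature.Analysis.UnboundedOperators.heatExtension_eq_integral_mul]
  unfold heatSmooth
  refine integral_congr_ae (ae_of_all _ fun y => ?_)
  show heatKernel t x y * g y = Literature.Analysis.UnboundedOperators.heatKernel (t / 2) (x - y) * g y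
  rw [heatKernel_eq_heatKernelUO]

/-- The kernel is symmetric. [folklore] -/
theorem heatKernel_symm (t : ℝ) (x y : ZM) : heatKernel t x y = heatKernel t y x := by
  unfold heatKernel
  rw [norm_sub_rev]

/-- The kernel is positive for `0 < t`. [folklore] -/
theorem heatKernel_pos' {t : ℝ} (ht : 0 < t) (x y : ZM) : 0 < heatKernel t x y := by
  rw [heatKernel_eq_heatKernelUO]
  exact Literature.Analysis.UnboundedOperators.heatKernel_pos (half_pos ht) _

/-- The kernel is continuous in the second variable. [folklore] -/
theorem continuous_heatKernel_right (t : ℝ) (x : ZM) : Continuous fun y => heatKernel t x y := by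
  have h : (fun y => heatKernel t x y) =
      fun y => Literature.Analysis.UnboundedOperators.heatKernel (t / 2) (x - y) := by
    funext y; rw [heatKernel_eq_heatKernelUO]
  rw [h]
  exact (Literature.Analysis.UnboundedOperators.continuous_heatKernel _).comp (continuous_const.sub continuous_id)

/-- `y ↦ p_t(x,y)` is integrable (`0 < t`). [folklore] -/
theorem integrable_heatKernel_right {t : ℝ} (ht : 0 < t) (x : ZM) : Integrable fun y => heatKernel t x y := by
  have h : (fun y => heatKernel t x y) =
      fun y => Literature.Analysis.UnboundedOperators.heatKernel (t / 2) (x - y) := by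
    funext y; rw [heatKernel_eq_heatKernelUO]
  rw [h]
  exact (Literature.Analysis.UnboundedOperators.integrable_heatKernel_holds (E := ZM) (half_pos ht)).comp_sub_left x

/-- Mass one: `∫ p_t(x,y) dy = 1` (`0 < t`). [folklore] -/
theorem integral_heatKernel_right {t : ℝ} (ht : 0 < t) (x : ZM) : ∫ y, heatKernel t x y = 1 := by
  have h : (fun y => heatKernel t x y) =
      fun y => Literature.Analysis.UnboundedOperators.heatKernel (t / 2) (x - y) := by
    funext y; rw [heatKernel_eq_heatKernelUO]
  rw [h, integral_sub_left_eq_self (Literature.Analysis.UnboundedOperators.heatKernel (t / 2)) volume x]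
  exact Literature.Analysis.UnboundedOperators.integral_heatKernel_eq_one_holds (half_pos ht)

/-- A bounded measurable function times the kernel is integrable in the second variable. [folklore] -/
theorem integrable_heatKernel_mul {t : ℝ} (ht : 0 < t) (x : ZM) {g : ZM → ℝ} (hm : Measurable g)
    {M : ℝ} (hb : ∀ y, |g y| ≤ M) : Integrable fun y => heatKernel t x y * g y := by
  refine ((integrable_heatKernel_right ht x).mul_const M).mono'
    ((continuous_heatKernel_right t x).measurable.mul hm).aestronglyMeasurable (ae_of_all _ fun y => ?_)
  rw [Real.norm_eq_abs, abs_mul, abs_of_nonneg ((heatKernel_pos' ht x y).le)]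
  exact mul_le_mul_of_nonneg_left (hb y) ((heatKernel_pos' ht x y).le)

/-- Bounded and integrable ⇒ square-integrable (`g² ≤ M|g|`). [folklore] -/
theorem integrable_sq_of_bounded_integrable {g : ZM → ℝ} (hm : Measurable g) {M : ℝ} (hb : ∀ y, |g y| ≤ M)
    (hi : Integrable g) : Integrable fun y => g y ^ 2 := by
  refine (hi.norm.mul_const M).mono' (hm.pow_const 2).aestronglyMeasurable (ae_of_all _ fun y => ?_)
  rw [Real.norm_eq_abs, Real.norm_eq_abs, abs_of_nonneg (sq_nonneg _), sq, ← abs_mul_abs_self]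
  exact mul_le_mul_of_nonneg_left (hb y) (abs_nonneg _)

/-- Bounded, measurable and integrable ⇒ `L²`. [folklore] -/
theorem memLp_two_of_bounded_integrable {g : ZM → ℝ} (hm : Measurable g) {M : ℝ} (hb : ∀ y, |g y| ≤ M)
    (hi : Integrable g) : MemLp g 2 volume :=
  (memLp_two_iff_integrable_sq hm.aestronglyMeasurable).2 (integrable_sq_of_bounded_integrable hm hb hi)

/-- **Maximum principle**: `|P_t g (x)| ≤ M` if `|g| ≤ M` (`0 < t`). [folklore] -/
theorem abs_heatSmooth_le {t : ℝ} (ht : 0 < t) {g : ZM → ℝ} {M : ℝ} (hb : ∀ y, |g y| ≤ M) (x : ZM) :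
    |heatSmooth t g x| ≤ M := by
  rw [heatSmooth_eq_heatExtension]
  have h := Literature.Analysis.UnboundedOperators.norm_heatExtension_le (E := ZM) (F := ℝ) (g := g)
    (fun z => by rw [Real.norm_eq_abs]; exact hb z) (half_pos ht) x
  simpa only [Real.norm_eq_abs] using h

/-- **Smoothing**: `P_s r ∈ C^n` for every `n`, for `r ∈ L^p`, `1 ≤ p` (tree `contDiff_heatExtension_holds`). [folklore] -/
theorem contDiff_heatSmooth {s : ℝ} (hs : 0 < s) {r : ZM → ℝ} {p : ENNReal} (hr : MemLp r p volume) (hp : 1 ≤ p)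
    (n : ℕ) : ContDiff ℝ n (heatSmooth s r) := by
  rw [heatSmooth_eq_heatExtension]
  exact (Literature.Analysis.UnboundedOperators.contDiff_heatExtension_holds hr hp (half_pos hs)).of_le
    (by exact_mod_cast le_top)

/-- `P_s r` is continuous for integrable `r`. [folklore] -/
theorem continuous_heatSmooth {s : ℝ} (hs : 0 < s) {r : ZM → ℝ} (hr : Integrable r) :
    Continuous (heatSmooth s r) :=
  (contDiff_heatSmooth hs (memLp_one_iff_integrable.2 hr) le_rfl 0).continuous

/-- `P_s r` is integrable for integrable `r`. [folklore] -/
theorem integrable_heatSmooth {s : ℝ} (hs : 0 < s) {r : ZM → ℝ} (hr : Integrable r) :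
    Integrable (heatSmooth s r) := by
  rw [heatSmooth_eq_heatExtension]
  exact Literature.Analysis.UnboundedOperators.integrable_heatExtension hr (half_pos hs)

/-- `P_s r ∈ L²` for `r ∈ L²` (contraction). [folklore] -/
theorem memLp_two_heatSmooth {s : ℝ} (hs : 0 < s) {r : ZM → ℝ} (hr : MemLp r 2 volume) :
    MemLp (heatSmooth s r) 2 volume := by
  rw [heatSmooth_eq_heatExtension]
  exact Literature.Analysis.UnboundedOperators.memLp_heatExtension_holds hr (by norm_num) (half_pos hs)

/-! ### §2. Symmetry identities and the smoothing defect -/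

/-- III.2a: `⟨g, P_t g⟩ = ‖P_{t/2} g‖²` for `g ∈ L²` (tree `integral_mul_heatExtension_eq_integral_sq`). [folklore] -/
theorem integral_mul_heatSmooth_eq_sq {t : ℝ} (ht : 0 < t) {g : ZM → ℝ} (hg : MemLp g 2 volume) :
    ∫ x, g x * heatSmooth t g x = ∫ x, heatSmooth (t / 2) g x ^ 2 := by
  rw [heatSmooth_eq_heatExtension, heatSmooth_eq_heatExtension]
  have h := Literature.Analysis.UnboundedOperators.integral_mul_heatExtension_eq_integral_sq (E := ZM) hg
    (half_pos ht)
  rw [h]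

/-- **Ledoux's smoothing defect** `∫ (f − P_s f)² ≤ (s/2) ∫ ‖Df‖²` for `C¹` `f` with `f, Df` bounded, `f² , ‖Df‖² ∈ L¹`
(tree `integral_sq_sub_heatExtension_le` at `τ = s/2`). [cite: Ledoux2003, §1] -/
theorem integral_sq_sub_heatSmooth_le {s : ℝ} (hs : 0 < s) {f : ZM → ℝ} (hf : ContDiff ℝ 1 f) {C₀ C₁ : ℝ}
    (h0 : ∀ z, ‖f z‖ ≤ C₀) (h1 : ∀ z, ‖fderiv ℝ f z‖ ≤ C₁) (hf2 : Integrable (fun z => f z ^ 2))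
    (hD2 : Integrable (fun z => ‖fderiv ℝ f z‖ ^ 2)) :
    ∫ x, (f x - heatSmooth s f x) ^ 2 ≤ s / 2 * ∫ x, ‖fderiv ℝ f x‖ ^ 2 := by
  rw [heatSmooth_eq_heatExtension]
  exact Literature.Analysis.UnboundedOperators.integral_sq_sub_heatExtension_le (half_pos hs) hf h0 h1 hf2 hD2

/-- **Transposition** `⟨P_s u, v⟩ = ⟨u, P_s v⟩` for `u, v ∈ L²` (the kernel is even; Fubini). [folklore] -/
theorem integral_heatSmooth_mul_comm {s : ℝ} (hs : 0 < s) {u v : ZM → ℝ} (hu : MemLp u 2 volume)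
    (hv : MemLp v 2 volume) :
    ∫ x, heatSmooth s u x * v x = ∫ x, u x * heatSmooth s v x := by
  rw [heatSmooth_eq_heatExtension, heatSmooth_eq_heatExtension]
  have hs2 := half_pos hs
  have hK1 := Literature.Analysis.UnboundedOperators.integrable_heatKernel_holds (E := ZM) hs2
  have hK2 : MemLp (Literature.Analysis.UnboundedOperators.heatKernel (E := ZM) (s / 2)) 2 volume :=
    Literature.Analysis.UnboundedOperators.memLp_heatKernel hs2 (by norm_num)
  have hint := Literature.Analysis.UnboundedOperators.integrable_kernel_mul_mul hK1 hK2 hu hv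
  have hsymm : ∀ z : ZM, Literature.Analysis.UnboundedOperators.heatKernel (s / 2) (-z) =
      1 * Literature.Analysis.UnboundedOperators.heatKernel (s / 2) z := fun z => by
    rw [Literature.Analysis.UnboundedOperators.heatKernel_neg, one_mul]
  have key := Literature.Analysis.UnboundedOperators.integral_convolution_mul_eq hsymm hint
  rw [one_mul] at key
  exact key

/-! ### §3. The jump expansion and the mass defect -/

/-- Pointwise expansion of the inner jump integral:
`∫ p_t(x,y) (g x − g y)² dy = g(x)² − 2 g(x)·P_t g(x) + P_t(g²)(x)` for bounded measurable `g`. [cite: LiebYau1988, (2.9)–(2.11)] -/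
theorem integral_heatKernel_mul_sub_sq {t : ℝ} (ht : 0 < t) {g : ZM → ℝ} (hm : Measurable g) {M : ℝ}
    (hb : ∀ y, |g y| ≤ M) (x : ZM) :
    ∫ y, heatKernel t x y * (g x - g y) ^ 2 =
      g x ^ 2 - 2 * (g x * heatSmooth t g x) + heatSmooth t (fun y => g y ^ 2) x := by
  have hM : 0 ≤ M := (abs_nonneg _).trans (hb x)
  have hb2 : ∀ y, |g y ^ 2| ≤ M ^ 2 := fun y => by
    rw [abs_pow]; exact pow_le_pow_left₀ (abs_nonneg _) (hb y) 2
  have I0 : Integrable fun y => heatKernel t x y := integrable_heatKernel_right ht x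
  have I1 : Integrable fun y => heatKernel t x y * g y := integrable_heatKernel_mul ht x hm hb
  have I2 : Integrable fun y => heatKernel t x y * g y ^ 2 := integrable_heatKernel_mul ht x (hm.pow_const 2) hb2
  have e : ∀ y, heatKernel t x y * (g x - g y) ^ 2 =
      g x ^ 2 * heatKernel t x y - 2 * g x * (heatKernel t x y * g y) + heatKernel t x y * g y ^ 2 := fun y => by ring
  simp_rw [e]
  have IAB : Integrable fun y => g x ^ 2 * heatKernel t x y - 2 * g x * (heatKernel t x y * g y) :=
    (I0.const_mul _).sub (I1.const_mul _)
  rw [integral_add IAB I2, integral_sub (I0.const_mul _) (I1.const_mul _),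
    integral_const_mul, integral_const_mul, integral_heatKernel_right ht x]
  unfold heatSmooth
  ring

/-- III.1′ **jump expansion**: `flatJump t g = t⁻¹ (∫ g² − ⟨g, P_t g⟩)` for bounded measurable integrable `g`
(Fubini; the heat flow preserves `∫ g²`). [cite: LiebYau1988, (2.9)–(2.11)] -/
theorem flatJump_eq_sub_inner {t : ℝ} (ht : 0 < t) {g : ZM → ℝ} (hm : Measurable g) {M : ℝ}
    (hb : ∀ y, |g y| ≤ M) (hi : Integrable g) :
    flatJump t g = (1 / t) * ((∫ x, g x ^ 2) - ∫ x, g x * heatSmooth t g x) := by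
  have hsq : Integrable fun y => g y ^ 2 := integrable_sq_of_bounded_integrable hm hb hi
  have hM : 0 ≤ M := (abs_nonneg _).trans (hb 0)
  -- integrability of `g · P_t g`
  have hc : Continuous (heatSmooth t g) := continuous_heatSmooth ht hi
  have Igp : Integrable fun x => g x * heatSmooth t g x := by
    refine (hi.norm.mul_const M).mono' (hm.mul hc.measurable).aestronglyMeasurable (ae_of_all _ fun x => ?_)
    rw [Real.norm_eq_abs, abs_mul, Real.norm_eq_abs]
    exact mul_le_mul_of_nonneg_left (abs_heatSmooth_le ht hb x) (abs_nonneg _)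
  have IP : Integrable (heatSmooth t fun y => g y ^ 2) := integrable_heatSmooth ht hsq
  unfold flatJump
  simp_rw [integral_heatKernel_mul_sub_sq ht hm hb]
  have IAB : Integrable fun x => g x ^ 2 - 2 * (g x * heatSmooth t g x) := hsq.sub (Igp.const_mul 2)
  rw [integral_add IAB IP, integral_sub hsq (Igp.const_mul 2), integral_const_mul]
  have hmass : ∫ x, heatSmooth t (fun y => g y ^ 2) x = ∫ x, g x ^ 2 := by
    rw [heatSmooth_eq_heatExtension]
    exact Literature.Analysis.UnboundedOperators.integral_heatExtension_eq hsq (half_pos ht)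
  rw [hmass]
  have ht0 : t ≠ 0 := ht.ne'
  field_simp
  ring

/-- III.1 **mass defect**: `flatJump t g = t⁻¹ (‖g‖² − ‖P_{t/2} g‖²)` for bounded measurable integrable `g`. [folklore] -/
theorem flatJump_eq_mass_defect {t : ℝ} (ht : 0 < t) {g : ZM → ℝ} (hm : Measurable g) {M : ℝ}
    (hb : ∀ y, |g y| ≤ M) (hi : Integrable g) :
    flatJump t g = (1 / t) * ((∫ x, g x ^ 2) - ∫ x, heatSmooth (t / 2) g x ^ 2) := by
  rw [flatJump_eq_sub_inner ht hm hb hi, integral_mul_heatSmooth_eq_sq ht (memLp_two_of_bounded_integrable hm hb hi)]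

/-- `‖P_{t/2} g‖² ≤ ‖g‖²` (contraction), in the form `0 ≤ flatJump`. [folklore] -/
theorem flatJump_nonneg {t : ℝ} (ht : 0 < t) (g : ZM → ℝ) : 0 ≤ flatJump t g := by
  unfold flatJump
  refine mul_nonneg (by positivity) (integral_nonneg fun x => integral_nonneg fun y => ?_)
  exact mul_nonneg ((heatKernel_pos' ht x y).le) (sq_nonneg _)

/-- The mass defect is nonnegative: `‖P_{t/2} g‖² ≤ ‖g‖²`. [folklore] -/
theorem integral_sq_heatSmooth_le {t : ℝ} (ht : 0 < t) {g : ZM → ℝ} (hm : Measurable g) {M : ℝ}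
    (hb : ∀ y, |g y| ≤ M) (hi : Integrable g) :
    ∫ x, heatSmooth (t / 2) g x ^ 2 ≤ ∫ x, g x ^ 2 := by
  have h := flatJump_nonneg ht g
  rw [flatJump_eq_mass_defect ht hm hb hi] at h
  have ht' : 0 < 1 / t := by positivity
  nlinarith [(mul_nonneg_iff_of_pos_left ht').1 h]

/-- The potential term of the Kac form is nonnegative, so `flatJump ≤ kacForm`. [folklore] -/
theorem flatJump_le_kacForm (t : ℝ) (g : ZM → ℝ) : flatJump t g ≤ kacForm t g := by
  unfold kacForm
  have : 0 ≤ ∫ x, luscherPotential x * g x ^ 2 :=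
    integral_nonneg fun x => mul_nonneg (luscherPotential_nonneg x) (sq_nonneg _)
  linarith

/-- `0 ≤ kacForm t g` for `0 < t`. [folklore] -/
theorem kacForm_nonneg {t : ℝ} (ht : 0 < t) (g : ZM → ℝ) : 0 ≤ kacForm t g :=
  (flatJump_nonneg ht g).trans (flatJump_le_kacForm t g)

end Summit.QuantumFields.YangMills.Theorems.FemtoTransferGap

end
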